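import Literature.NumberTheory.EllipticCurves.ZpExtensionEisensteinDVRSettingDualityDataProofs
import HarnessLib

/-!
# The instantiated H.4 data at a UNIT TWIST `κ.unitTwist u` (the shared μ-crux's `κ⁻ = κ.unitTwist (-1)`): anticyclotomicity is
# stable under unit twists (proofs file)

Topic `NumberTheory/EllipticCurves` (cell `pub/bsd-print-x9`; sequel to `ZpExtensionEisensteinDVRSettingDualityDataProofs`).
THEOREMS ONLY; no definition, no named fact, no instance, no notation, no `sorry`.

D1's STUB-A recipe builds Howard's setting at `St := W.eisensteinDVRSettingLevelsTame (κ.unitTwist (-1)) hm …` for an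
ANTICYCLOTOMIC `κ` (Greenberg: `Gal(K_∞/ℚ)` generalised dihedral, `κ(cgc⁻¹) = κ(g)⁻¹`).  The instantiated H.4 data
`WeierstrassCurve.exists_eisensteinDualityData` ask for anticyclotomicity of the twisting extension itself; this file supplies the
one-line bridge:
* **`ZpExtension.IsAnticyclotomic.unitTwist`** — `κ` anticyclotomic ⇒ `κ.unitTwist u` anticyclotomic (`(u·x)⁻¹ = u·x⁻¹` in `ℤ_p`);
* **`WeierstrassCurve.exists_eisensteinDualityData_unitTwist`** — the H.4 data `D`, the Weil–`τ` forms and `e_red`/H.5(c) for the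
  tower `W.eisensteinTower (κ.unitTwist u) hm` from `κ.IsAnticyclotomic` (verbatim `exists_eisensteinDualityData` at `κ.unitTwist u`).

BSD is not proved by any of this.

References: [Greenberg1999LNM] §1 (anticyclotomic `ℤ_p`-extensions); [Howard2004HeegnerKolyvagin] §1.3 H.4, §2.2 (the twist by `ψ`).
-/

set_option autoImplicit false

noncomputable section

open Function NumberField IsDedekindDomain Field
open scoped NumberField ContRepresentation TensorProduct Classical

namespace Literature.NumberTheory.EllipticCurves.ZpExtension

open Literature.NumberTheory.GaloisRepresentations

/-- **Anticyclotomicity is stable under unit twists**: if `κ(τ) = κ(σ)⁻¹` whenever `res τ = ρ · res σ · ρ⁻¹` (`ρ ∉ im Γ_K`), then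
the same holds for `u • κ` (`u ∈ ℤ_pˣ`). [cite: Greenberg1999LNM, §1 (anticyclotomic ℤ_p-extensions)] -/
theorem IsAnticyclotomic.unitTwist {K : Type} [Field K] [NumberField K] {p : ℕ} [Fact p.Prime] {κ : ZpExtension K p}
    (hκ : κ.IsAnticyclotomic) (u : ℤ_[p]ˣ) : (κ.unitTwist u).IsAnticyclotomic := by
  intro σ τ ρ hρ hres
  rw [unitTwist_apply, unitTwist_apply, hκ σ τ ρ hρ hres, toAdd_inv, mul_neg, ofAdd_neg]

end Literature.NumberTheory.EllipticCurves.ZpExtension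

namespace WeierstrassCurve

open Literature.NumberTheory.EllipticCurves Literature.NumberTheory.GaloisRepresentations
open Literature.NumberTheory.GaloisRepresentations.DiscreteGaloisModule
open Literature.NumberTheory.GaloisCohomology.Howard2004
open Literature.NumberTheory.EllipticCurves.ZpExtension (EisensteinLevel eisensteinLevel)

variable {K : Type} [Field K] [NumberField K] (W : WeierstrassCurve ℚ) [W.IsElliptic] {p : ℕ} [hp : Fact p.Prime]
  (κ : ZpExtension K p) (u : ℤ_[p]ˣ) {m : ℕ} (hm : 1 ≤ m)
  (S : Finset (HeightOneSpectrum (𝓞 K)))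
  (hpS : ∀ v : HeightOneSpectrum (𝓞 K), ((p : ℕ) : 𝓞 K) ∈ v.asIdeal → v ∈ S)
  (hbad : ∀ v : HeightOneSpectrum (𝓞 K), v ∉ S → ((p : ℕ) : 𝓞 K) ∉ v.asIdeal → (W.baseChange K).HasGoodReductionAt v)
  (L : Set (HeightOneSpectrum (𝓞 K)))
  (hL : letI := IwasawaAlgebra.isLocalRing_quotient_X_pow_add_C p hm
    L ⊆ (W.eisensteinTower (κ.unitTwist u) hm).degreeTwoPrimes p)
  (hLS : ∀ v ∈ L, v ∉ S)
  (jbar : AlgebraicClosure K →+* ℂ) (cd : ConjugationDatum K)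

set_option synthInstance.maxHeartbeats 80000 in
set_option maxHeartbeats 800000 in
/-- **The instantiated H.4 data for the tower at a unit twist** `κ.unitTwist u` of an anticyclotomic `κ` (the shared μ-crux's
`κ⁻ = κ.unitTwist (-1)`): verbatim `exists_eisensteinDualityData` at `κ.unitTwist u`, its anticyclotomicity hypothesis discharged by
`IsAnticyclotomic.unitTwist`. [cite: Howard2004HeegnerKolyvagin, §1.3 H.4, H.5(c), Rem. 1.3.2 and §1.6 (arXiv p. 7 L69–101, p. 11 L33–38)]
[cite: Greenberg1999LNM, §1] -/
theorem exists_eisensteinDualityData_unitTwist (hκ : κ.IsAnticyclotomic)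
    (himag : ∀ w : NumberField.InfinitePlace K, w.IsComplex)
    {c₀ : absoluteGaloisGroup ℚ} (hc₀ : IsComplexConjugation (Rat.castHom ℝ) c₀)
    (hτ : ∀ x, cd.τ x = absGaloisTransport (K := ℚ) (L := K) c₀ x) :
    letI := IwasawaAlgebra.isDomain_quotient_X_pow_add_C p hm
    letI := IwasawaAlgebra.isDiscreteValuationRing_quotient_X_pow_add_C p hm
    haveI := IwasawaAlgebra.EisensteinCoeff.isLocalRing_succ p hm
    letI := IwasawaAlgebra.EisensteinCoeff.algebraOfSpecSucc p m
    haveI := W.isScalarTower_algebraOfSpecSucc (K := K) (p := p) (m := m)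
    letI := W.residueModuleSucc (K := K) (p := p) hm
    ∃ (D : ∀ k, DualityDatum p cd ((W.eisensteinTower (κ.unitTwist u) hm).ρ k)
        (IwasawaAlgebra.EisensteinCoeff p m (k + 1)))
      (e : ∀ j : ℕ, geomTorsion (W.baseChange K) ((p : ℤ) ^ j) →+ geomTorsion (W.baseChange K) ((p : ℤ) ^ j) →+
        MuCarrier K (p ^ j))
      (log : ∀ j : ℕ, MuCarrier K (p ^ j) →+ ZMod (p ^ j)),
      (∀ k, (D k).e = ZpExtension.eisensteinDualityForm hm (k + 1)
        (conjPairing (e (k + 1)) (cd.isLift.torsionMap W _) (log (k + 1)))) ∧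
      (∀ k (x y : EisensteinLevel p m (fun j ↦ geomTorsion (W.baseChange K) ((p : ℤ) ^ j)) (k + 1 + 1)),
        IwasawaAlgebra.EisensteinCoeff.reduce p m (Nat.le_succ (k + 1)) ((D (k + 1)).e x y) =
          (D k).e ((W.eisensteinTower (κ.unitTwist u) hm).red k x) ((W.eisensteinTower (κ.unitTwist u) hm).red k y)) ∧
      (∀ (fs : ∀ (k : ℕ) (n : Finset (HeightOneSpectrum (𝓞 K))) (v : HeightOneSpectrum (𝓞 K)),
          galoisCohomology ((W.eisensteinLevelQuot (κ.unitTwist u) hm k n).toLocal (Sum.inr v)) 1 →+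
            SingularQuotient (GaloisRep.toLocal v (W.eisensteinLevelQuot (κ.unitTwist u) hm k n)) ⊗[ℤ] Gell v) (k : ℕ),
        H5c (D k) ((W.eisensteinDVRSetting (κ.unitTwist u) hm S hpS hbad L hL hLS jbar cd D fs).πbar k)
          (W.residualTauGeomTorsion (p := p) cd hm (k := k + 1) k.succ_pos)) ∧
      (∀ j a, e j a a = 0) ∧
      (∀ j (g : absoluteGaloisGroup K) a b, e j (g • a) (g • b) = mu K (p ^ j) g (e j a b)) ∧
      (∀ j a b, e j (cd.isLift.torsionMap W _ a) (cd.isLift.torsionMap W _ b) = -e j a b) ∧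
      (∀ j (a : geomTorsion (W.baseChange K) ((p : ℤ) ^ j)),
        cd.isLift.torsionMap W _ (cd.isLift.torsionMap W _ a) = a) ∧
      (∀ j, Function.Bijective (log j)) ∧
      (∀ j (g : absoluteGaloisGroup K) ξ, log j (mu K (p ^ j) g ξ) = cyclotomicCharacterModPow K p j g * log j ξ) :=
  W.exists_eisensteinDualityData (κ.unitTwist u) hm S hpS hbad L hL hLS jbar cd (hκ.unitTwist u) himag hc₀ hτ

end WeierstrassCurve

end
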